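import Mathlib.Analysis.InnerProductSpace.PiL2
import Mathlib.Analysis.Complex.Basic
import Mathlib.Geometry.Manifold.ChartedSpace
import Mathlib.Tactic

/-!
# Level sets of the wedge coordinate `T_H` are flat two-chart spheres, and compact
(registered helpers `helper_wedgeLevelSetH` and `helper_wedgeLevelCompactH` of line
`cross-cap-laurent`, crux `GromovRecognitionRelEnd`, item stmt-SmoothPoincare4-11009)

In the wedge cap `X` the chart `ηH : ℝ⁴ → X` lives on the open polydisc
`D_H = {|(p 2, p 3)| < R₁⁻¹}` and the corner chart `ηC : ℝ⁴ → X` on the bidisc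
`D_C = {|(p 0, p 1)| < R₁⁻¹, |(p 2, p 3)| < R₁⁻¹}`; the two are glued by complex inversion of the
first factor, `ηC (u, t) = ηH (1/u, t)` for `u ≠ 0`.  The coordinate `T : X → ℂ` of
`helper_wedgeCoordinateH` reads the second complex factor through both charts:
`T (ηH p) = p 2 + i p 3` on `D_H` and `T (ηC p) = p 2 + i p 3` on `D_C`.

* `helper_wedgeLevelSetH`: for `‖t‖ < R₁⁻¹` the level set `{y ∈ ηH '' D_H ∪ ηC '' D_C | T y = t}`
  is the flat leaf `z ↦ ηH (z, t)` closed up by the single point `ηC (0, t)`.  Pure set algebra: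
  a point `ηH p` of the level set has `(p 2, p 3) = (t.re, t.im)`, so it is `ηH (z, t)` with
  `z = p 0 + i p 1`; a point `ηC p` of the level set is `ηH (1/u, t)` by the gluing clause if
  `u = p 0 + i p 1 ≠ 0`, and the extra point if `u = 0`; conversely `(z, t) ∈ D_H` and
  `(0, t) ∈ D_C` since `t.re ^ 2 + t.im ^ 2 = ‖t‖ ^ 2 < R₁⁻¹ ^ 2`.
* `helper_wedgeLevelCompactH`: the level set is compact.  With `r = R₁ + 1 > R₁` it equals
  `ηH ((closed ball of radius r) × {t}) ∪ ηC ((closed ball of radius r⁻¹) × {t})`: a point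
  `ηH (z, t)` with `‖z‖ > r` is `ηC (1/z, t)` by the gluing clause (`‖1/z‖ < r⁻¹ < R₁⁻¹`), and the
  extra point is `ηC (0, t)`; both pieces are continuous images of compact balls (the slices lie
  in `D_H`, resp. `D_C`, where `ηH`, resp. `ηC`, is continuous).  This is the proof of
  `helper_wedgeSphereHClosed` (the case `t = 0`) transported to the slice at height `t`.

Everything is proved from Mathlib topology; no definition, no named fact.
-/

-- the registered namespace `Summit.SmoothPoincare4.SmoothPoincare4.Theorems…` repeats a component
set_option linter.dupNamespace false

open Set Metric

namespace Summit.SmoothPoincare4.SmoothPoincare4.Theorems.GromovRecognitionRelEnd.CrossCapLaurent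

/-- For `‖t‖ < R₁⁻¹`, the real coordinates of `t` lie in the disc of radius `R₁⁻¹`:
`t.re ^ 2 + t.im ^ 2 < R₁⁻¹ ^ 2`. -/
private lemma wedgeLevelH_re_sq_add_im_sq_lt {R₁ : ℝ} {t : ℂ} (ht : ‖t‖ < R₁⁻¹) :
    t.re ^ 2 + t.im ^ 2 < R₁⁻¹ ^ 2 := by
  have h : t.re ^ 2 + t.im ^ 2 = ‖t‖ ^ 2 := by
    rw [← Complex.normSq_eq_norm_sq, Complex.normSq_apply]
    ring
  rw [h]
  exact pow_lt_pow_left₀ ht (norm_nonneg t) two_ne_zero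

/-- **Level sets of the wedge coordinate `T_H` are flat leaves closed up by one point.**  Given the
gluing clause `ηC p = ηH (complex inverse of (p 0, p 1), p 2, p 3)` off the axis `p 0 = p 1 = 0`
and a coordinate `T` with `T (ηH p) = p 2 + i p 3` on the polydisc `{p 2 ^ 2 + p 3 ^ 2 < R₁⁻¹ ^ 2}`
and `T (ηC p) = p 2 + i p 3` on the bidisc `{p 0 ^ 2 + p 1 ^ 2 < R₁⁻¹ ^ 2, p 2 ^ 2 + p 3 ^ 2 <
R₁⁻¹ ^ 2}`, for every `t` with `‖t‖ < R₁⁻¹` the level set `{T = t}` inside the union of the two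
chart images is `{ηH (z, t) | z : ℂ} ∪ {ηC (0, t)}`. -/
theorem helper_wedgeLevelSetH : ∀ (X : Type) (R₁ : ℝ) (ηH ηC : EuclideanSpace ℝ (Fin 4) → X) (T : X → ℂ), 0 < R₁ → (∀ p : EuclideanSpace ℝ (Fin 4), p 0 ^ 2 + p 1 ^ 2 < R₁⁻¹ ^ 2 → p 2 ^ 2 + p 3 ^ 2 < R₁⁻¹ ^ 2 → (p 0 ≠ 0 ∨ p 1 ≠ 0) → ηC p = ηH (WithLp.toLp 2 ![p 0 / (p 0 ^ 2 + p 1 ^ 2), -(p 1) / (p 0 ^ 2 + p 1 ^ 2), p 2, p 3])) → (∀ p : EuclideanSpace ℝ (Fin 4), p 2 ^ 2 + p 3 ^ 2 < R₁⁻¹ ^ 2 → T (ηH p) = ⟨p 2, p 3⟩) → (∀ p : EuclideanSpace ℝ (Fin 4), p 0 ^ 2 + p 1 ^ 2 < R₁⁻¹ ^ 2 → p 2 ^ 2 + p 3 ^ 2 < R₁⁻¹ ^ 2 → T (ηC p) = ⟨p 2, p 3⟩) → ∀ t : ℂ, ‖t‖ < R₁⁻¹ → {y : X | y ∈ (ηH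 '' {p : EuclideanSpace ℝ (Fin 4) | p 2 ^ 2 + p 3 ^ 2 < R₁⁻¹ ^ 2} ∪ ηC '' {p : EuclideanSpace ℝ (Fin 4) | p 0 ^ 2 + p 1 ^ 2 < R₁⁻¹ ^ 2 ∧ p 2 ^ 2 + p 3 ^ 2 < R₁⁻¹ ^ 2}) ∧ T y = t} = Set.range (fun z : ℂ => ηH (WithLp.toLp 2 ![z.re, z.im, t.re, t.im])) ∪ {ηC (WithLp.toLp 2 ![0, 0, t.re, t.im])} := by
  intro X R₁ ηH ηC T hR₁ hglue hTH hTC t ht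
  have hR : (0 : ℝ) < R₁⁻¹ ^ 2 := by positivity
  have htt : t.re ^ 2 + t.im ^ 2 < R₁⁻¹ ^ 2 := wedgeLevelH_re_sq_add_im_sq_lt ht
  ext y
  simp only [mem_setOf_eq, mem_union, mem_range, mem_singleton_iff]
  constructor
  · rintro ⟨hy | hy, hT0⟩
    · -- `y = ηH p` with `(p 2, p 3) = (t.re, t.im)`: a point of the flat leaf `ηH (ℂ × {t})`
      obtain ⟨p, hp, rfl⟩ := hy
      rw [hTH p hp] at hT0
      have h2 : p 2 = t.re := by simpa using congrArg Complex.re hT0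
      have h3 : p 3 = t.im := by simpa using congrArg Complex.im hT0
      refine Or.inl ⟨⟨p 0, p 1⟩, ?_⟩
      show ηH _ = ηH p
      congr 1
      ext i
      fin_cases i <;> simp [h2, h3]
    · -- `y = ηC p` with `(p 2, p 3) = (t.re, t.im)`: off the first axis `ηC p = ηH (1 / u, t)`,
      -- on the axis `p = (0, t)`
      obtain ⟨p, hp, rfl⟩ := hy
      rw [hTC p hp.1 hp.2] at hT0
      have h2 : p 2 = t.re := by simpa using congrArg Complex.re hT0
      have h3 : p 3 = t.im := by simpa using congrArg Complex.im hT0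
      by_cases h01 : p 0 ≠ 0 ∨ p 1 ≠ 0
      · refine Or.inl ⟨⟨p 0 / (p 0 ^ 2 + p 1 ^ 2), -(p 1) / (p 0 ^ 2 + p 1 ^ 2)⟩, ?_⟩
        show ηH _ = ηC p
        rw [hglue p hp.1 hp.2 h01]
        congr 1
        ext i
        fin_cases i <;> simp [h2, h3]
      · simp only [not_or, not_not] at h01
        have hp0 : p = WithLp.toLp 2 ![0, 0, t.re, t.im] := by
          ext i
          fin_cases i <;> simp [h01.1, h01.2, h2, h3]
        exact Or.inr (congrArg ηC hp0)
  · rintro (⟨z, rfl⟩ | rfl)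
    · -- the flat leaf: `ηH (z, t) ∈ ηH '' D_H` and `T = t.re + i t.im = t` there
      have hmem : (WithLp.toLp 2 ![z.re, z.im, t.re, t.im] : EuclideanSpace ℝ (Fin 4)) ∈
          {p : EuclideanSpace ℝ (Fin 4) | p 2 ^ 2 + p 3 ^ 2 < R₁⁻¹ ^ 2} := by
        simpa using htt
      exact ⟨Or.inl ⟨_, hmem, rfl⟩, by rw [hTH _ hmem]; simp⟩
    · -- the closing point `ηC (0, t)`, with `(0, t) ∈ D_C`
      have hmem : (WithLp.toLp 2 ![0, 0, t.re, t.im] : EuclideanSpace ℝ (Fin 4)) ∈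
          {p : EuclideanSpace ℝ (Fin 4) | p 0 ^ 2 + p 1 ^ 2 < R₁⁻¹ ^ 2 ∧
            p 2 ^ 2 + p 3 ^ 2 < R₁⁻¹ ^ 2} := by
        rw [mem_setOf_eq]
        exact ⟨by simpa using hR, by simpa using htt⟩
      exact ⟨Or.inr ⟨_, hmem, rfl⟩, by rw [hTC _ hmem.1 hmem.2]; simp⟩

/-- **Level sets of the wedge coordinate `T_H` are compact.**  For a Hausdorff space `X`, a chart
`ηH` continuous on the polydisc `{p 2 ^ 2 + p 3 ^ 2 < R₁⁻¹ ^ 2}`, a corner chart `ηC` continuous on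
the bidisc `{p 0 ^ 2 + p 1 ^ 2 < R₁⁻¹ ^ 2, p 2 ^ 2 + p 3 ^ 2 < R₁⁻¹ ^ 2}`, the gluing clause
`ηC p = ηH (complex inverse of (p 0, p 1), p 2, p 3)` off the axis `p 0 = p 1 = 0`, and a
coordinate `T` reading `p 2 + i p 3` through both charts, every level set `{T = t}`,
`‖t‖ < R₁⁻¹`, inside the union of the two chart images is compact: by `helper_wedgeLevelSetH` it
is `{ηH (z, t)} ∪ {ηC (0, t)}`, which is the union of the continuous images of the compact slices
`closedBall 0 (R₁ + 1) × {t}` under `ηH` and `closedBall 0 (R₁ + 1)⁻¹ × {t}` under `ηC`. -/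
theorem helper_wedgeLevelCompactH : ∀ (X : Type) [TopologicalSpace X] [T2Space X] [ChartedSpace (EuclideanSpace ℝ (Fin 4)) X] (R₁ : ℝ) (ηH ηC : EuclideanSpace ℝ (Fin 4) → X) (T : X → ℂ), 0 < R₁ → ContinuousOn ηH {p : EuclideanSpace ℝ (Fin 4) | p 2 ^ 2 + p 3 ^ 2 < R₁⁻¹ ^ 2} → ContinuousOn ηC {p : EuclideanSpace ℝ (Fin 4) | p 0 ^ 2 + p 1 ^ 2 < R₁⁻¹ ^ 2 ∧ p 2 ^ 2 + p 3 ^ 2 < R₁⁻¹ ^ 2} → (∀ p : EuclideanSpace ℝ (Fin 4), p 0 ^ 2 + p 1 ^ 2 < R₁⁻¹ ^ 2 → p 2 ^ 2 + p 3 ^ 2 < R₁⁻¹ ^ 2 → (p 0 ≠ 0 ∨ p 1 ≠ 0) → ηC p = ηH (WithLp.toLp 2 ![p 0 / (p 0 ^ 2 + p 1 ^ 2), -(p 1) / (p 0 ^ 2 + p 1 ^ 2), p 2, p 3])) → (∀ p : EuclideanSpace ℝ (Fin 4), p 2 ^ 2 + p 3 ^ 2 < R₁⁻¹ ^ 2 →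 T (ηH p) = ⟨p 2, p 3⟩) → (∀ p : EuclideanSpace ℝ (Fin 4), p 0 ^ 2 + p 1 ^ 2 < R₁⁻¹ ^ 2 → p 2 ^ 2 + p 3 ^ 2 < R₁⁻¹ ^ 2 → T (ηC p) = ⟨p 2, p 3⟩) → ∀ t : ℂ, ‖t‖ < R₁⁻¹ → IsCompact {y : X | y ∈ (ηH '' {p : EuclideanSpace ℝ (Fin 4) | p 2 ^ 2 + p 3 ^ 2 < R₁⁻¹ ^ 2} ∪ ηC '' {p : EuclideanSpace ℝ (Fin 4) | p 0 ^ 2 + p 1 ^ 2 < R₁⁻¹ ^ 2 ∧ p 2 ^ 2 + p 3 ^ 2 < R₁⁻¹ ^ 2}) ∧ T y = t} := by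
  intro X _ _ _ R₁ ηH ηC T hR₁ hH hC hglue hTH hTC t ht
  rw [helper_wedgeLevelSetH X R₁ ηH ηC T hR₁ hglue hTH hTC t ht]
  -- the slice `e z = (z, t)` of the first complex factor at height `t`
  set e : ℂ → EuclideanSpace ℝ (Fin 4) := fun z => WithLp.toLp 2 ![z.re, z.im, t.re, t.im]
    with he_def
  have he : Continuous e := by
    refine (PiLp.continuous_toLp 2 _).comp (continuous_pi fun i => ?_)
    fin_cases i
    · exact Complex.continuous_re
    · exact Complex.continuous_im
    · exact continuous_const
    · exact continuous_const
  have he0 : ∀ z : ℂ, e z 0 = z.re := fun z => by simp [he_def]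
  have he1 : ∀ z : ℂ, e z 1 = z.im := fun z => by simp [he_def]
  have he2 : ∀ z : ℂ, e z 2 = t.re := fun z => by simp [he_def]
  have he3 : ∀ z : ℂ, e z 3 = t.im := fun z => by simp [he_def]
  have he_zero : e 0 = WithLp.toLp 2 ![0, 0, t.re, t.im] := by
    simp [he_def]
  -- radii: `r = R₁ + 1 > R₁`, so `r⁻¹ < R₁⁻¹`
  set r : ℝ := R₁ + 1 with hr_def
  have hr : 0 < r := by linarith
  have hrR : r⁻¹ < R₁⁻¹ := inv_strictAnti₀ hR₁ (by linarith)
  have hrR2 : r⁻¹ ^ 2 < R₁⁻¹ ^ 2 := pow_lt_pow_left₀ hrR (inv_pos.mpr hr).le two_ne_zero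
  -- the slice lies in the two polydiscs
  have htt : t.re ^ 2 + t.im ^ 2 < R₁⁻¹ ^ 2 := wedgeLevelH_re_sq_add_im_sq_lt ht
  have hnorm : ∀ w : ℂ, e w 0 ^ 2 + e w 1 ^ 2 = ‖w‖ ^ 2 := fun w => by
    rw [he0, he1, ← Complex.normSq_eq_norm_sq, Complex.normSq_apply]
    ring
  have hsmall : ∀ w : ℂ, ‖w‖ ≤ r⁻¹ → e w 0 ^ 2 + e w 1 ^ 2 < R₁⁻¹ ^ 2 := fun w hw => by
    rw [hnorm]
    calc ‖w‖ ^ 2 ≤ r⁻¹ ^ 2 := by gcongr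
      _ < R₁⁻¹ ^ 2 := hrR2
  have hsec : ∀ w : ℂ, e w 2 ^ 2 + e w 3 ^ 2 < R₁⁻¹ ^ 2 := fun w => by
    rw [he2, he3]
    exact htt
  -- the gluing clause on the slice: `ηC (w, t) = ηH (1/w, t)` for `0 < ‖w‖ ≤ r⁻¹`
  have hglue' : ∀ w : ℂ, w ≠ 0 → ‖w‖ ≤ r⁻¹ → ηC (e w) = ηH (e w⁻¹) := by
    intro w hw hwr
    have hne : e w 0 ≠ 0 ∨ e w 1 ≠ 0 := by
      rw [he0, he1]
      by_contra h
      push Not at h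
      exact hw (Complex.ext (by simpa using h.1) (by simpa using h.2))
    have hsq : w.re ^ 2 + w.im ^ 2 = Complex.normSq w := by
      rw [Complex.normSq_apply]
      ring
    have hinv : e w⁻¹ = WithLp.toLp 2
        ![e w 0 / (e w 0 ^ 2 + e w 1 ^ 2), -(e w 1) / (e w 0 ^ 2 + e w 1 ^ 2), e w 2, e w 3] := by
      rw [he0, he1, he2, he3, hsq]
      change WithLp.toLp 2 ![(w⁻¹).re, (w⁻¹).im, t.re, t.im] = _
      rw [Complex.inv_re, Complex.inv_im]
    rw [hinv]
    exact hglue (e w) (hsmall w hwr) (hsec w) hne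
  -- the two compact pieces
  have hK₁ : IsCompact ((ηH ∘ e) '' closedBall (0 : ℂ) r) :=
    (isCompact_closedBall (0 : ℂ) r).image_of_continuousOn
      (hH.comp he.continuousOn fun z _ => hsec z)
  have hK₂ : IsCompact ((ηC ∘ e) '' closedBall (0 : ℂ) r⁻¹) :=
    (isCompact_closedBall (0 : ℂ) r⁻¹).image_of_continuousOn
      (hC.comp he.continuousOn fun w hw => ⟨hsmall w (mem_closedBall_zero_iff.mp hw), hsec w⟩)
  -- the level set is their union
  have hEq : Set.range (fun z : ℂ => ηH (WithLp.toLp 2 ![z.re, z.im, t.re, t.im])) ∪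
      {ηC (WithLp.toLp 2 ![0, 0, t.re, t.im])} =
      (ηH ∘ e) '' closedBall (0 : ℂ) r ∪ (ηC ∘ e) '' closedBall (0 : ℂ) r⁻¹ := by
    apply Set.Subset.antisymm
    · rintro y (⟨z, rfl⟩ | rfl)
      · change ηH (e z) ∈ _
        by_cases hz : ‖z‖ ≤ r
        · exact Or.inl ⟨z, mem_closedBall_zero_iff.mpr hz, rfl⟩
        · push Not at hz
          have hz0 : z ≠ 0 := norm_pos_iff.mp (hr.trans hz)
          have hzr : ‖z⁻¹‖ ≤ r⁻¹ := by
            rw [norm_inv]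
            exact inv_anti₀ hr hz.le
          refine Or.inr ⟨z⁻¹, mem_closedBall_zero_iff.mpr hzr, ?_⟩
          change ηC (e z⁻¹) = ηH (e z)
          rw [hglue' z⁻¹ (inv_ne_zero hz0) hzr, inv_inv]
      · refine Or.inr ⟨0, mem_closedBall_self (inv_pos.mpr hr).le, ?_⟩
        change ηC (e 0) = ηC (WithLp.toLp 2 ![0, 0, t.re, t.im])
        rw [he_zero]
    · rintro y (⟨z, -, rfl⟩ | ⟨w, hw, rfl⟩)
      · exact Or.inl ⟨z, rfl⟩
      · by_cases hw0 : w = 0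
        · subst hw0
          right
          change ηC (e 0) ∈ ({ηC (WithLp.toLp 2 ![0, 0, t.re, t.im])} : Set X)
          rw [he_zero]
          exact Set.mem_singleton _
        · left
          refine ⟨w⁻¹, ?_⟩
          change ηH (e w⁻¹) = ηC (e w)
          exact (hglue' w hw0 (mem_closedBall_zero_iff.mp hw)).symm
  rw [hEq]
  exact hK₁.union hK₂

end Summit.SmoothPoincare4.SmoothPoincare4.Theorems.GromovRecognitionRelEnd.CrossCapLaurent
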